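import Mathlib

/-!
# Sketch — crux-ideate k2 g28, crux `SignedMuSeedAtTwoPlus` (stmt-BirchSwinnertonDyer-21438), idea `nonsquare-descent`

First checkable lemma of the line (pure algebra, proved): the SQUARES DICHOTOMY engine.
Arithmetic instance: `V n = 𝓔(M_n)^χ / 2` (χ-part of the 2-adic units of the n-th layer of the
cyclotomic ℤ₂-tower of the S₃-sextic `M = ℚ(W[2])`, modulo squares), `ι n` = inclusion (injective
because `M_{n+1} = M_n(√α_n)` with `v_𝔓(α_n) = 3` odd), `N n` = norm, which on `V (n+1)` is
multiplication by `(γ-1)^{2^n} = X^{2^n}` (char 2), `u n` = class of the Robert elliptic χ-unit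
`η_n^{2-σ-σ²}` (norm-coherent by Robert's distribution relation for `(2) ∣ 𝔪`).
Conclusion: if the Λ-adic class `ū_∞` is `X`-power torsion then every `u n` is `0`, i.e. the
elliptic χ-units are squares at EVERY level.  Contrapositive = the one-level certificate
`GNS(m) ⟹ ū_∞ generates a free 𝔽₄⟦X⟧-line`.
BSD is not proved here; the crux is not proved here.
-/

namespace Summit.BirchSwinnertonDyer.BirchSwinnertonDyer.Cruxes.SignedMuSeedAtTwoPlus.NonsquareDescent

open Polynomial

variable {R : Type*} [CommRing R]
variable (V : ℕ → Type*) [∀ n, AddCommGroup (V n)] [∀ n, Module R[X] (V n)]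

/-- Squares dichotomy (abstract engine).  A norm-coherent family `u` in a tower of
`R[X]`-modules with injective transition maps `ι n : V n → V (n+1)` and norms `N n` satisfying
`ι n (N n v) = X^(2^n) • v` is identically zero as soon as a fixed power of `X` kills every `u n`. -/
theorem squaresDichotomy
    (ι : ∀ n, V n →ₗ[R[X]] V (n + 1)) (hι : ∀ n, Function.Injective (ι n))
    (N : ∀ n, V (n + 1) →ₗ[R[X]] V n)
    (hN : ∀ n (v : V (n + 1)), ι n (N n v) = (X : R[X]) ^ (2 ^ n) • v)
    (u : ∀ n, V n) (hu : ∀ n, N n (u (n + 1)) = u n)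
    (a : ℕ) (ha : ∀ n, (X : R[X]) ^ a • u n = 0) :
    ∀ n, u n = 0 := by
  -- Step 1: levels `n` with `a ≤ 2^n` vanish, by injectivity of `ι n`.
  have high : ∀ n, a ≤ 2 ^ n → u n = 0 := by
    intro n hn
    apply hι n
    rw [map_zero, ← hu n, hN n]
    have : (X : R[X]) ^ (2 ^ n) = (X : R[X]) ^ (2 ^ n - a) * (X : R[X]) ^ a := by
      rw [← pow_add, Nat.sub_add_cancel hn]
    rw [this, mul_smul, ha (n + 1), smul_zero]
  -- Step 2: descend with the norm relation.
  have down : ∀ k n, u (n + k) = 0 → u n = 0 := by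
    intro k
    induction k with
    | zero => intro n h; simpa using h
    | succ k ih =>
        intro n h
        apply ih
        rw [← hu (n + k), show n + (k + 1) = n + k + 1 by omega] at *
        rw [h, map_zero]
  intro n
  -- `a ≤ 2^(n + a)` always holds.
  refine down a n (high (n + a) ?_)
  calc a ≤ 2 ^ a := Nat.lt_two_pow_self.le
    _ ≤ 2 ^ (n + a) := Nat.pow_le_pow_right (by norm_num) (by omega)

/-- The one-level certificate, contrapositive form: if some `u m ≠ 0` then no power of `X`
kills the whole family (so, over a DVR quotient like `𝔽₄⟦X⟧`, the limit class is non-torsion). -/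
theorem not_torsion_of_exists_ne_zero
    (ι : ∀ n, V n →ₗ[R[X]] V (n + 1)) (hι : ∀ n, Function.Injective (ι n))
    (N : ∀ n, V (n + 1) →ₗ[R[X]] V n)
    (hN : ∀ n (v : V (n + 1)), ι n (N n v) = (X : R[X]) ^ (2 ^ n) • v)
    (u : ∀ n, V n) (hu : ∀ n, N n (u (n + 1)) = u n)
    (m : ℕ) (hm : u m ≠ 0) :
    ∀ a : ℕ, ∃ n, (X : R[X]) ^ a • u n ≠ 0 := by
  intro a
  by_contra h
  push Not at h
  exact hm (squaresDichotomy V ι hι N hN u hu a h m)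

/-- Quadratic square descent (field-level core of the injectivity `𝓔(M_n)/2 ↪ 𝓔(M_{n+1})/2`):
in a quadratic extension `F' = F ⊕ F·s`, `s² = α`, an element of `F` that becomes a square in `F'`
is already `a²` or `α·b²` in `F`.  Arithmetic use: `F = M_n`, `α = α_n = 2 + ζ_{2^{n+2}} + ζ_{2^{n+2}}⁻¹`
has ODD valuation `3` at the prime of `M_n` over `2`, so for a UNIT `x` the case `x = α b²` is
impossible and `x` is a square of a unit of `M_n`. -/
theorem sq_descent_quadratic {F F' : Type*} [Field F] [Field F'] [Algebra F F'] [NeZero (2 : F)]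
    (α : F) (s : F') (hs : s ^ 2 = algebraMap F F' α)
    (hnot : s ∉ Set.range (algebraMap F F'))
    (x a b : F) (hx : algebraMap F F' x = (algebraMap F F' a + algebraMap F F' b * s) ^ 2) :
    x = a ^ 2 ∨ x = α * b ^ 2 := by
  have key : algebraMap F F' (2 * a * b) * s = algebraMap F F' (x - a ^ 2 - α * b ^ 2) := by
    simp only [map_sub, map_mul, map_pow, map_ofNat]
    linear_combination (-1 : F') * hx - (algebraMap F F' b) ^ 2 * hs
  by_cases hab : 2 * a * b = 0
  · rw [hab, map_zero, zero_mul, eq_comm, map_eq_zero_iff _ (algebraMap F F').injective] at key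
    rcases mul_eq_zero.mp hab with h2a | hb
    · rcases mul_eq_zero.mp h2a with h2 | ha
      · exact absurd h2 (NeZero.ne 2)
      · right; rw [ha] at key; linear_combination key
    · left; rw [hb] at key; linear_combination key
  · exfalso
    apply hnot
    refine ⟨(x - a ^ 2 - α * b ^ 2) / (2 * a * b), ?_⟩
    rw [map_div₀, ← key, mul_div_cancel_left₀]
    exact (map_ne_zero_iff _ (algebraMap F F').injective).mpr hab

end Summit.BirchSwinnertonDyer.BirchSwinnertonDyer.Cruxes.SignedMuSeedAtTwoPlus.NonsquareDescent
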